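import Summits.Langlands.Langlands.Theorems.PotentialCompanionDescentBrauerTaylorDescentGaloisTransport
import Literature.NumberTheory.GaloisRepresentations.InducedGaloisRep
import Literature.RepresentationTheory.FiniteGroups.MackeyIntertwining
import HarnessLib

/-!
# Brauer–Taylor descent for `PotentialCompanionDescent.BrauerTaylorDescent` — companion transport

Part 2b of the lineage programme for the Brauer–Taylor descent of companions
(Barnet-Lamb–Gee–Geraghty–Taylor 2014, Thm. 5.5.1).  Given number fields `K ⊆ E`, a subgroup
`H ≤ Γ_K` and `c ∈ Γ_K` with `res(Γ_E) = c H c⁻¹` (the situation produced by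
`exists_conj_range_absGaloisRestrict_fixedField_iff` for `H = π⁻¹(H̄)`, `E = L^{H̄}`), there is a
continuous homomorphism (in fact a topological isomorphism)

* `exists_transport`: `t : H →ₜ* Γ_E` with `res (t h) = c h c⁻¹` (`h ↦ res⁻¹(c h c⁻¹)`,
  continuous because `res` is an open embedding); any such `t` is bijective
  (`transport_injective`, `transport_surjective`).

No definitions are introduced: every statement below is about an ARBITRARY continuous `t` with
`res ∘ t = c (·) c⁻¹`, and the transported companion is the framed representation `σ.comp t` of
`H`.  The two facts fed to virtual Brauer descent:

* `comp_transport_eq_one_of_mem_inertia` — if `σ` is unramified above `v`, then `σ ∘ t` kills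
  `H ∩ I_𝔓` for every `𝔓 ∣ v`;
* `exists_charpoly_comp_transport_eq` — if `(ρ|_{Γ_E}, σ)` are companions above `v`, then at every
  `h ∈ H` which is an arithmetic Frobenius of `K` above `v`, `charpoly ρ(h)` and
  `charpoly (σ ∘ t)(h)` are the two Frobenius polynomials of ONE Satake parameter at `N v`; hence
  (`charpoly_comp_transport_eq_of_companion`) two such transports have EQUAL characteristic
  polynomials at Frobenius elements with the same `charpoly ρ`.

References: Barnet-Lamb–Gee–Geraghty–Taylor, Ann. of Math. 179 (2014), proof of Thm. 5.5.1;
Neukirch, *Algebraic Number Theory*, Ch. I §9.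
-/

set_option linter.dupNamespace false

noncomputable section

open Field IsDedekindDomain NumberField Polynomial Topology
open Literature.NumberTheory.GaloisRepresentations Literature.NumberTheory.Automorphic
open scoped NumberField Pointwise

namespace Summit.Langlands.Langlands.Theorems.BrauerTaylorDescent

/-! ### The transport `H → Γ_E` -/

section Transport

variable {K E : Type} [Field K] [NumberField K] [Field E] [NumberField E] [Algebra K E]
  {H : Subgroup (absoluteGaloisGroup K)} {c : absoluteGaloisGroup K}

/-- **The transport homomorphism.**  If `res(Γ_E) = c H c⁻¹`, there is a continuous homomorphism
`t : H → Γ_E` with `res (t h) = c h c⁻¹`, namely `h ↦ res⁻¹(c h c⁻¹)`; it is continuous because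
`res : Γ_E → Γ_K` is an open embedding (`isOpenEmbedding_absGaloisRestrict`). [folklore] -/
theorem exists_transport (hc : ∀ γ, γ ∈ (absGaloisRestrict K E).range ↔ c⁻¹ * γ * c ∈ H) :
    ∃ t : H →ₜ* absoluteGaloisGroup E, ∀ h : H,
      absGaloisRestrict K E (t h) = c * h * c⁻¹ := by
  -- `h ↦ c h c⁻¹ : H → res(Γ_E)`
  let κ : H →* (absGaloisRestrict K E).range :=
    { toFun := fun h => ⟨c * h * c⁻¹, (hc _).2 (by
        rw [show c⁻¹ * (c * (h : absoluteGaloisGroup K) * c⁻¹) * c = h by group]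
        exact h.2)⟩
      map_one' := Subtype.ext (by simp)
      map_mul' := fun a b => Subtype.ext (by
        show c * ((a : absoluteGaloisGroup K) * b) * c⁻¹ = c * a * c⁻¹ * (c * b * c⁻¹)
        group) }
  have hκ : Continuous κ :=
    continuous_induced_rng.2 ((continuous_const.mul continuous_subtype_val).mul continuous_const)
  -- `res⁻¹ : res(Γ_E) → Γ_E`
  let j : (absGaloisRestrict K E).range →* absoluteGaloisGroup E :=
    (MonoidHom.ofInjective (absGaloisRestrict_injective K E)).symm.toMonoidHom
  have hj' : ∀ x, absGaloisRestrict K E (j x) = x := fun x =>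
    MonoidHom.apply_ofInjective_symm (absGaloisRestrict_injective K E) x
  have hj : Continuous j := by
    rw [(isOpenEmbedding_absGaloisRestrict K E).isEmbedding.continuous_iff]
    have : (absGaloisRestrict K E) ∘ j = Subtype.val := funext fun x => hj' x
    rw [this]
    exact continuous_subtype_val
  exact ⟨{ toMonoidHom := j.comp κ, continuous_toFun := hj.comp hκ }, fun h => hj' _⟩

omit [NumberField K] [NumberField E] in
/-- A transport is injective. [folklore] -/
theorem transport_injective (t : H →ₜ* absoluteGaloisGroup E)
    (ht : ∀ h : H, absGaloisRestrict K E (t h) = c * h * c⁻¹) : Function.Injective t := by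
  intro a b h
  have h' := congrArg (absGaloisRestrict K E) h
  rw [ht, ht] at h'
  exact Subtype.ext (mul_left_cancel (mul_right_cancel h'))

/-- A transport is surjective. [folklore] -/
theorem transport_surjective (hc : ∀ γ, γ ∈ (absGaloisRestrict K E).range ↔ c⁻¹ * γ * c ∈ H)
    (t : H →ₜ* absoluteGaloisGroup E)
    (ht : ∀ h : H, absGaloisRestrict K E (t h) = c * h * c⁻¹) : Function.Surjective t := by
  intro τ
  refine ⟨⟨c⁻¹ * absGaloisRestrict K E τ * c, (hc _).1 ⟨τ, rfl⟩⟩,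
    absGaloisRestrict_injective K E ?_⟩
  rw [ht]
  show c * (c⁻¹ * absGaloisRestrict K E τ * c) * c⁻¹ = absGaloisRestrict K E τ
  group

/-! ### Inertia and Frobenius under transport -/

omit [NumberField K] [NumberField E] [Algebra K E] in
/-- Conjugating an inertia element: `x ∈ I_𝔓 ⇒ c x c⁻¹ ∈ I_{c𝔓}`. [folklore] -/
theorem conj_mem_inertia_smul {𝔓 : Ideal (absIntegers (𝓞 K) K)} {x : absoluteGaloisGroup K}
    (hx : x ∈ 𝔓.inertia (absoluteGaloisGroup K)) (c : absoluteGaloisGroup K) :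
    c * x * c⁻¹ ∈ (c • 𝔓).inertia (absoluteGaloisGroup K) := by
  intro z
  have h2 : c • (x • (c⁻¹ • z) - c⁻¹ • z) ∈ c • 𝔓 :=
    Ideal.smul_mem_pointwise_smul_iff.2 (hx (c⁻¹ • z))
  simpa [smul_sub, mul_smul] using h2

variable {A : Type} [CommRing A] [TopologicalSpace A] {n : ℕ}

/-- **Unramified above `v` ⇒ the transport kills `H ∩ I_𝔓`, `𝔓 ∣ v`.** [folklore] -/
theorem comp_transport_eq_one_of_mem_inertia (t : H →ₜ* absoluteGaloisGroup E)
    (ht : ∀ h : H, absGaloisRestrict K E (t h) = c * h * c⁻¹)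
    (σ : FramedGaloisRep E A n) {v : HeightOneSpectrum (𝓞 K)}
    (hσ : ∀ w : HeightOneSpectrum (𝓞 E), w.asIdeal.under (𝓞 K) = v.asIdeal → σ.IsUnramifiedAt w)
    {𝔓 : Ideal (absIntegers (𝓞 K) K)} (h𝔓 : 𝔓 ∈ v.primesAbove) {h : H}
    (hh : (h : absoluteGaloisGroup K) ∈ 𝔓.inertia (absoluteGaloisGroup K)) :
    σ.comp t h = 1 := by
  rw [ContinuousMonoidHom.comp_toFun]
  refine apply_eq_one_of_absGaloisRestrict_mem_inertia σ hσ (smul_mem_primesAbove h𝔓 c) ?_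
  rw [ht]
  exact conj_mem_inertia_smul hh c

omit [NumberField K] [NumberField E] [Algebra K E] in
/-- Characteristic polynomials of a framed representation are conjugation invariant. [folklore] -/
theorem charpoly_conj {G : Type} [Group G] [TopologicalSpace G] (ρ : FramedRep G A n)
    (c x : G) : FramedRep.charpoly ρ (c * x * c⁻¹) = FramedRep.charpoly ρ x := by
  simp only [FramedRep.charpoly, map_mul, map_inv, Units.val_mul, Matrix.coe_units_inv]
  exact Matrix.charpoly_units_conj (ρ c) _

variable {ℓ : ℕ} [Fact ℓ.Prime]

/-- **Companions match at transported Frobenii.**  If `(ρ|_{Γ_E}, σ)` have a common Satake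
parameter at every place of `E` above `v`, then at every `h ∈ H` which is an arithmetic Frobenius
of `K` at a prime above `v`, `charpoly ρ(h)` and `charpoly (σ ∘ t)(h)` are the two Frobenius
polynomials of one Satake parameter at `N v` (`c h c⁻¹ = res(t h)` is a Frobenius at `c • 𝔓`,
Mathlib `IsArithFrobAt.conj`; then `exists_charpoly_eq_of_companion` and conjugation invariance).
BLGGT 2014, proof of Thm. 5.5.1. [folklore] -/
theorem exists_charpoly_comp_transport_eq (ι : PadicAlgCl ℓ ≃+* ℂ) (ι₂ : PadicAlgCl 2 ≃+* ℂ)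
    (ρ : FramedGaloisRep K (PadicAlgCl ℓ) n) (t : H →ₜ* absoluteGaloisGroup E)
    (ht : ∀ h : H, absGaloisRestrict K E (t h) = c * h * c⁻¹)
    (σ : FramedGaloisRep E (PadicAlgCl 2) n) {v : HeightOneSpectrum (𝓞 K)}
    (hmatch : ∀ w : HeightOneSpectrum (𝓞 E), w.asIdeal.under (𝓞 K) = v.asIdeal →
      ∃ α : Multiset ℂ,
        (ρ.restrictField E).HasFrobCharpolyAt w (arithFrobPolyOfSatake ι w.residueCard 1 α) ∧
        σ.HasFrobCharpolyAt w (arithFrobPolyOfSatake ι₂ w.residueCard 1 α))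
    {𝔓 : Ideal (absIntegers (𝓞 K) K)} (h𝔓 : 𝔓 ∈ v.primesAbove) {h : H}
    (hh : IsArithFrobAt (𝓞 K) (h : absoluteGaloisGroup K) 𝔓) :
    ∃ α : Multiset ℂ, FramedRep.charpoly ρ (h : absoluteGaloisGroup K) =
        arithFrobPolyOfSatake ι v.residueCard 1 α ∧
      FramedRep.charpoly (σ.comp t) h = arithFrobPolyOfSatake ι₂ v.residueCard 1 α := by
  have hconj : IsArithFrobAt (𝓞 K) (absGaloisRestrict K E (t h)) (c • 𝔓) := by
    rw [ht]
    exact hh.conj c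
  obtain ⟨α, h1, h2⟩ :=
    exists_charpoly_eq_of_companion ι ι₂ ρ σ hmatch (smul_mem_primesAbove h𝔓 c) hconj
  refine ⟨α, ?_, h2⟩
  rw [← h1, ht, charpoly_conj]

/-- **Two transported companions agree at matching Frobenii.**  If `σ` over `E` and `σ'` over `E'`
are both companions of `ρ` above `v`, transported along `t : H → Γ_E`, `t' : H' → Γ_{E'}`, then at
Frobenius elements `h ∈ H`, `h' ∈ H'` of `K` above `v` with `charpoly ρ(h) = charpoly ρ(h')` the
two transports have the same characteristic polynomial (the Satake dictionary is injective,
`arithFrobPolyOfSatake_injective`). [folklore] -/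
theorem charpoly_comp_transport_eq_of_companion (ι : PadicAlgCl ℓ ≃+* ℂ) (ι₂ : PadicAlgCl 2 ≃+* ℂ)
    (ρ : FramedGaloisRep K (PadicAlgCl ℓ) n) (t : H →ₜ* absoluteGaloisGroup E)
    (ht : ∀ h : H, absGaloisRestrict K E (t h) = c * h * c⁻¹)
    (σ : FramedGaloisRep E (PadicAlgCl 2) n)
    {E' : Type} [Field E'] [NumberField E'] [Algebra K E']
    {H' : Subgroup (absoluteGaloisGroup K)} {c' : absoluteGaloisGroup K}
    (t' : H' →ₜ* absoluteGaloisGroup E')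
    (ht' : ∀ h : H', absGaloisRestrict K E' (t' h) = c' * h * c'⁻¹)
    (σ' : FramedGaloisRep E' (PadicAlgCl 2) n)
    {v : HeightOneSpectrum (𝓞 K)}
    (hmatch : ∀ w : HeightOneSpectrum (𝓞 E), w.asIdeal.under (𝓞 K) = v.asIdeal →
      ∃ α : Multiset ℂ,
        (ρ.restrictField E).HasFrobCharpolyAt w (arithFrobPolyOfSatake ι w.residueCard 1 α) ∧
        σ.HasFrobCharpolyAt w (arithFrobPolyOfSatake ι₂ w.residueCard 1 α))
    (hmatch' : ∀ w : HeightOneSpectrum (𝓞 E'), w.asIdeal.under (𝓞 K) = v.asIdeal →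
      ∃ α : Multiset ℂ,
        (ρ.restrictField E').HasFrobCharpolyAt w (arithFrobPolyOfSatake ι w.residueCard 1 α) ∧
        σ'.HasFrobCharpolyAt w (arithFrobPolyOfSatake ι₂ w.residueCard 1 α))
    {𝔓 𝔓' : Ideal (absIntegers (𝓞 K) K)} (h𝔓 : 𝔓 ∈ v.primesAbove) (h𝔓' : 𝔓' ∈ v.primesAbove)
    {h : H} {h' : H'} (hh : IsArithFrobAt (𝓞 K) (h : absoluteGaloisGroup K) 𝔓)
    (hh' : IsArithFrobAt (𝓞 K) (h' : absoluteGaloisGroup K) 𝔓')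
    (heq : FramedRep.charpoly ρ (h : absoluteGaloisGroup K) =
      FramedRep.charpoly ρ (h' : absoluteGaloisGroup K)) :
    FramedRep.charpoly (σ.comp t) h = FramedRep.charpoly (σ'.comp t') h' := by
  obtain ⟨α, hα1, hα2⟩ := exists_charpoly_comp_transport_eq ι ι₂ ρ t ht σ hmatch h𝔓 hh
  obtain ⟨β, hβ1, hβ2⟩ := exists_charpoly_comp_transport_eq ι ι₂ ρ t' ht' σ' hmatch' h𝔓' hh'
  have hαβ : α = β :=
    arithFrobPolyOfSatake_injective ι (zero_lt_one.trans v.one_lt_residueCard) 1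
      (hα1.symm.trans (heq.trans hβ1))
  rw [hα2, hβ2, hαβ]

end Transport

/-! ### Openness bookkeeping in `Γ_K` -/

section Open

variable {Γ : Type} [Group Γ] [TopologicalSpace Γ] [IsTopologicalGroup Γ]

/-- `g⁻¹ S g` is open if `S` is. [folklore] -/
theorem isOpen_conjSubgroup {S : Subgroup Γ} (hS : IsOpen (S : Set Γ)) (g : Γ) :
    IsOpen (Literature.RepresentationTheory.FiniteGroups.conjSubgroup S g : Set Γ) :=
  hS.preimage ((continuous_const.mul continuous_id).mul continuous_const)

/-- Mackey's subgroup `T ∩ g⁻¹ S g` is open in `T` if `S` is open. [folklore] -/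
theorem isOpen_mackeySubgroup {S : Subgroup Γ} (T : Subgroup Γ) (hS : IsOpen (S : Set Γ)) (g : Γ) :
    IsOpen (Literature.RepresentationTheory.FiniteGroups.mackeySubgroup S T g : Set T) :=
  (isOpen_conjSubgroup hS g).preimage continuous_subtype_val

/-- Mackey's conjugation map `T ∩ g⁻¹ S g → S` is continuous. [folklore] -/
theorem continuous_mackeyConjHom (S T : Subgroup Γ) (g : Γ) :
    Continuous (Literature.RepresentationTheory.FiniteGroups.mackeyConjHom S T g) :=
  continuous_induced_rng.2
    ((continuous_const.mul (continuous_subtype_val.comp continuous_subtype_val)).mul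
      continuous_const)

end Open

end Summit.Langlands.Langlands.Theorems.BrauerTaylorDescent

end
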